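import Summits.CriticalPhenomena.PercolationContinuityZ3.Theorems.PercNearOneGluingAdditiveGluingSetObserverLemmaU
import HarnessLib

/-!
# Sandwich BHK for a SET observer — II: the sandwich function of an observer set inside `U`; base case

Crux `PercNearOneGluing.AdditiveGluing` (stmt-CriticalPhenomena-4576), stub `stub_goodStep` (stub-plan prover; towards
the two-relay drift theorem = `stub_blockGoodTwo` at `A.card = 3`, see part I `…SetObserverLemmaU.lean`).  Set-observer
versions of seat k41's `…SandwichLemmaU.lean` (second half) and of the base case of `…SandwichCoreS.lean`; lands
`--supports stmt-CriticalPhenomena-4576`; no definitions, no named facts.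

Notation (BHK finite-sum framework; part I): source `s`, observer SET `O : Finset V`, `R_X = {s ↮ X}` (`rD U s X` inside
`U`), `K_O = ⋃_{o ∈ O} C_o` (`⋃ o ∈ O, rC U o ω` inside `U`), `s ↔ O` = `∃ o ∈ O, s ↔ o`, and the SET sandwich function
`g^(T) = 1{s ↔ O} + 1{s ↮ O} · h(K_O) · 1{O ↮ T}` for an arbitrary `h : Set (Sym2 V) → [0,1]` (inside `U`:
`if ∃ o ∈ O, (openGraph (ω ∩ edgesIn U)).Reachable s o then 1 else h (⋃ o ∈ O, rC U o ω) * ind (⋂ o ∈ O, rD U o T) ω`).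
* `lemmaU_set_restrict` — Lemma U (part I) for the model restricted to `U`;
* `sandS_*` / `sandH_*` — bounds, monotonicity in `T`, and BHK's identity (6) for `g^(T)` and for the CUT sandwich function
  `ĝ^(T) = 1{O ↮ T} · (1{s ↔ O} + 1{s ↮ O} h(K_O))` (needed for Lemma 3 with a set observer: `ĝ` represents `1_Q`, `g` represents `1 − 1_Q`);
* `coreS_abs_base` — **Theorem S for an observer set, base case `X ∩ Y = ∅`** (abstract sandwich function):
  `E[F(C_s) 1_{R_X}] · E[g^(Y) 1_{R_Y}] ≤ E[F(C_s) g^(∅)] · P(R_{X∪Y})` (Harris twice, Lemma U twice), `F ≥ 0` increasing.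
[cite: VandenbergHaggstromKahn2005, Thm. 1.1 (pp. 3–5), §1 p. 4 identity (6), p. 8]
-/

noncomputable section

open MeasureTheory unitInterval
open Literature.Probability.LatticeModels (prodBernoulli)
open Literature.Probability.Percolation
open Literature.Probability.Percolation.BHK2006

namespace Summit.CriticalPhenomena.PercolationContinuityZ3.Theorems

namespace SandwichSet

open scoped Classical
open DecisionTree (ind ind_of_mem ind_of_not_mem ind_nonneg)
open SandwichK41

variable {V : Type*} [Fintype V]

/-! ### Lemma U for the model restricted to `U` -/

/-- **Lemma U for an observer set, model restricted to `U`**: `E[F(C_s^U)] E[g₀^U] ≤ E[F(C_s^U) g₀^U]`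
(part I's `lemmaU_set` for the weights switched off outside `edgesIn U`, by marginalisation). [folklore] -/
theorem lemmaU_set_restrict (w : Sym2 V → ℝ) (hw0 : ∀ e, 0 ≤ w e) (hw1 : ∀ e, w e ≤ 1)
    (hm : ∑ ω, weight w ω = 1) (U : Finset V) (s : V) (O : Finset V) (F : Set (Sym2 V) → ℝ)
    (hF : Monotone F) (h : Set (Sym2 V) → ℝ) (h1 : ∀ C, h C ≤ 1) :
    (∑ ω, weight w ω * F (rC U s ω)) *
        (∑ ω, weight w ω *
          (if ∃ o ∈ O, (openGraph (ω ∩ edgesIn U)).Reachable s o then (1 : ℝ)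
            else h (⋃ o ∈ O, rC U o ω))) ≤
      ∑ ω, weight w ω * (F (rC U s ω) *
          (if ∃ o ∈ O, (openGraph (ω ∩ edgesIn U)).Reachable s o then (1 : ℝ)
            else h (⋃ o ∈ O, rC U o ω))) := by
  obtain ⟨wA, hwA0, hwA1, hmA, htr⟩ := restrict_model w hw0 hw1 hm (edgesIn U)
  have e1 := htr fun ω => F (openEdgeCluster ω s)
  have e2 := htr fun ω => if ∃ o ∈ O, (openGraph ω).Reachable s o then (1 : ℝ)
    else h (⋃ o ∈ O, openEdgeCluster ω o)
  have e3 := htr fun ω => F (openEdgeCluster ω s) *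
    (if ∃ o ∈ O, (openGraph ω).Reachable s o then (1 : ℝ) else h (⋃ o ∈ O, openEdgeCluster ω o))
  simp only [rC] at *
  rw [e1, e2, e3]
  exact lemmaU_set O wA hwA0 hwA1 hmA s F hF h h1

/-! ### The set sandwich function inside `U` -/

/-- `0 ≤ g^(T)` inside `U` (for `0 ≤ h`). [folklore] -/
theorem sandS_nonneg (U : Finset V) (s : V) (O : Finset V) {h : Set (Sym2 V) → ℝ} (h0 : ∀ C, 0 ≤ h C)
    (T : Set V) (ω : Set (Sym2 V)) :
    0 ≤ (if ∃ o ∈ O, (openGraph (ω ∩ edgesIn U)).Reachable s o then (1 : ℝ)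
      else h (⋃ o ∈ O, rC U o ω) * ind (⋂ o ∈ O, rD U o T) ω) := by
  split_ifs
  · exact zero_le_one
  · exact mul_nonneg (h0 _) (ind_nonneg _ _)

/-- `g^(T)` is antitone in the constraint set `T` (for `0 ≤ h`). [folklore] -/
theorem sandS_antitone (U : Finset V) (s : V) (O : Finset V) {h : Set (Sym2 V) → ℝ} (h0 : ∀ C, 0 ≤ h C)
    {T T' : Set V} (hTT' : T ⊆ T') (ω : Set (Sym2 V)) :
    (if ∃ o ∈ O, (openGraph (ω ∩ edgesIn U)).Reachable s o then (1 : ℝ)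
      else h (⋃ o ∈ O, rC U o ω) * ind (⋂ o ∈ O, rD U o T') ω) ≤
    (if ∃ o ∈ O, (openGraph (ω ∩ edgesIn U)).Reachable s o then (1 : ℝ)
      else h (⋃ o ∈ O, rC U o ω) * ind (⋂ o ∈ O, rD U o T) ω) := by
  split_ifs
  · exact le_rfl
  · refine mul_le_mul_of_nonneg_left (ind_mono (fun ξ hξ => ?_) ω) (h0 _)
    simp only [Set.mem_iInter] at hξ ⊢
    exact fun o ho => rD_antitone hTT' (hξ o ho)

/-- With the empty constraint set, `g^(∅) = g₀` inside `U`. [folklore] -/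
theorem sandS_empty (U : Finset V) (s : V) (O : Finset V) (h : Set (Sym2 V) → ℝ) (ω : Set (Sym2 V)) :
    (if ∃ o ∈ O, (openGraph (ω ∩ edgesIn U)).Reachable s o then (1 : ℝ)
      else h (⋃ o ∈ O, rC U o ω) * ind (⋂ o ∈ O, rD U o (∅ : Set V)) ω) =
    (if ∃ o ∈ O, (openGraph (ω ∩ edgesIn U)).Reachable s o then (1 : ℝ)
      else h (⋃ o ∈ O, rC U o ω)) := by
  have : ω ∈ ⋂ o ∈ O, rD U o (∅ : Set V) := by
    simp only [Set.mem_iInter]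
    exact fun o _ x hx => absurd hx (Set.notMem_empty x)
  rw [ind_of_mem this, mul_one]

omit [Fintype V] in
/-- Membership in `⋂_{o ∈ O} R_T(o)` of `G[U ∖ Z]` does not depend on the pairs meeting `Z`. [folklore] -/
theorem mem_iInter_rD_diff_meeting (U Z : Finset V) (O : Finset V) (T : Set V) (η : Set (Sym2 V)) :
    η \ meeting Z ∈ (⋂ o ∈ O, rD (U \ Z) o T) ↔ η ∈ ⋂ o ∈ O, rD (U \ Z) o T := by
  simp only [Set.mem_iInter]
  exact forall₂_congr fun o _ => mem_rD_diff_meeting U Z o T η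

/-- The set sandwich function of `G[U ∖ Z]` does not depend on the pairs meeting `Z`. [folklore] -/
theorem sandS_diff_meeting (U Z : Finset V) (s : V) (O : Finset V) (h : Set (Sym2 V) → ℝ) (T : Set V)
    (η : Set (Sym2 V)) :
    (if ∃ o ∈ O, (openGraph ((η \ meeting Z) ∩ edgesIn (U \ Z))).Reachable s o then (1 : ℝ)
      else h (⋃ o ∈ O, rC (U \ Z) o (η \ meeting Z)) * ind (⋂ o ∈ O, rD (U \ Z) o T) (η \ meeting Z)) =
    (if ∃ o ∈ O, (openGraph (η ∩ edgesIn (U \ Z))).Reachable s o then (1 : ℝ)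
      else h (⋃ o ∈ O, rC (U \ Z) o η) * ind (⋂ o ∈ O, rD (U \ Z) o T) η) := by
  have hind : ind (⋂ o ∈ O, rD (U \ Z) o T) (η \ meeting Z) = ind (⋂ o ∈ O, rD (U \ Z) o T) η := by
    by_cases hη : η ∈ ⋂ o ∈ O, rD (U \ Z) o T
    · rw [ind_of_mem hη, ind_of_mem ((mem_iInter_rD_diff_meeting U Z O T η).2 hη)]
    · rw [ind_of_not_mem hη, ind_of_not_mem (fun h' => hη ((mem_iInter_rD_diff_meeting U Z O T η).1 h'))]
  simp only [rC_diff_meeting]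
  rw [diff_meeting_inter_edgesIn, hind]

/-- **BHK's restriction for the set sandwich function**: for `W ⊇ Z` with `s ∉ Z` and `O ∩ Z = ∅`, on the
event that no vertex of `S(ω)` is joined to `s` in `G[U ∖ Z]`, `g^(W)` of `G[U]` equals
`g^((W ∖ Z) ∪ S(ω))` of `G[U ∖ Z]`. [cite: VandenbergHaggstromKahn2005, §1 p. 4, identity (6)] -/
theorem sandS_restrict {U Z : Finset V} (hZU : Z ⊆ U) {s : V} (hs : s ∉ Z) {O : Finset V}
    (hO : ∀ o ∈ O, o ∉ Z) (h : Set (Sym2 V) → ℝ) {W : Set V} (hZW : (↑Z : Set V) ⊆ W) {ω : Set (Sym2 V)}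
    (hS : ∀ n ∈ rS U Z ω, ¬ (openGraph (ω ∩ edgesIn (U \ Z))).Reachable s n) :
    (if ∃ o ∈ O, (openGraph (ω ∩ edgesIn U)).Reachable s o then (1 : ℝ)
      else h (⋃ o ∈ O, rC U o ω) * ind (⋂ o ∈ O, rD U o W) ω) =
    (if ∃ o ∈ O, (openGraph (ω ∩ edgesIn (U \ Z))).Reachable s o then (1 : ℝ)
      else h (⋃ o ∈ O, rC (U \ Z) o ω) * ind (⋂ o ∈ O, rD (U \ Z) o ((W \ ↑Z) ∪ rS U Z ω)) ω) := by
  have hreach : (∃ o ∈ O, (openGraph (ω ∩ edgesIn U)).Reachable s o) ↔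
      ∃ o ∈ O, (openGraph (ω ∩ edgesIn (U \ Z))).Reachable s o :=
    exists_congr fun o => and_congr_right fun _ => reachable_restrict_iff hs hS o
  by_cases hr : ∃ o ∈ O, (openGraph (ω ∩ edgesIn (U \ Z))).Reachable s o
  · rw [if_pos (hreach.2 hr), if_pos hr]
  · rw [if_neg (fun h' => hr (hreach.1 h')), if_neg hr]
    have hmem : ω ∈ (⋂ o ∈ O, rD U o W) ↔ ω ∈ ⋂ o ∈ O, rD (U \ Z) o ((W \ ↑Z) ∪ rS U Z ω) := by
      simp only [Set.mem_iInter]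
      exact forall₂_congr fun o ho => mem_rD_iff_restrict hZU (hO o ho) hZW ω
    by_cases hω : ω ∈ ⋂ o ∈ O, rD U o W
    · have hω' := hmem.1 hω
      rw [ind_of_mem hω, ind_of_mem hω']
      congr 2
      refine Set.iUnion₂_congr fun o ho => rC_restrict (hO o ho) fun n hn => ?_
      exact (Set.mem_iInter₂.1 hω' o ho) n (Or.inr hn)
    · rw [ind_of_not_mem hω, ind_of_not_mem (fun h' => hω (hmem.2 h')), mul_zero, mul_zero]

/-! ### The CUT sandwich function `ĝ^(T) = 1{O ↮ T} · (1{s ↔ O} + 1{s ↮ O} h(K_O))` -/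

/-- `0 ≤ ĝ^(T)` inside `U` (for `0 ≤ h`). [folklore] -/
theorem sandH_nonneg (U : Finset V) (s : V) (O : Finset V) {h : Set (Sym2 V) → ℝ} (h0 : ∀ C, 0 ≤ h C)
    (T : Set V) (ω : Set (Sym2 V)) :
    0 ≤ ind (⋂ o ∈ O, rD U o T) ω * (if ∃ o ∈ O, (openGraph (ω ∩ edgesIn U)).Reachable s o then (1 : ℝ)
      else h (⋃ o ∈ O, rC U o ω)) := by
  refine mul_nonneg (ind_nonneg _ _) ?_
  split_ifs
  · exact zero_le_one
  · exact h0 _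

/-- `ĝ^(T)` is antitone in `T` (for `0 ≤ h`). [folklore] -/
theorem sandH_antitone (U : Finset V) (s : V) (O : Finset V) {h : Set (Sym2 V) → ℝ} (h0 : ∀ C, 0 ≤ h C)
    {T T' : Set V} (hTT' : T ⊆ T') (ω : Set (Sym2 V)) :
    ind (⋂ o ∈ O, rD U o T') ω * (if ∃ o ∈ O, (openGraph (ω ∩ edgesIn U)).Reachable s o then (1 : ℝ)
      else h (⋃ o ∈ O, rC U o ω)) ≤
    ind (⋂ o ∈ O, rD U o T) ω * (if ∃ o ∈ O, (openGraph (ω ∩ edgesIn U)).Reachable s o then (1 : ℝ)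
      else h (⋃ o ∈ O, rC U o ω)) := by
  refine mul_le_mul_of_nonneg_right (ind_mono (fun ξ hξ => ?_) ω) ?_
  · simp only [Set.mem_iInter] at hξ ⊢
    exact fun o ho => rD_antitone hTT' (hξ o ho)
  · split_ifs
    · exact zero_le_one
    · exact h0 _

/-- `ĝ^(∅) = g₀` inside `U`. [folklore] -/
theorem sandH_empty (U : Finset V) (s : V) (O : Finset V) (h : Set (Sym2 V) → ℝ) (ω : Set (Sym2 V)) :
    ind (⋂ o ∈ O, rD U o (∅ : Set V)) ω * (if ∃ o ∈ O, (openGraph (ω ∩ edgesIn U)).Reachable s o then (1 : ℝ)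
      else h (⋃ o ∈ O, rC U o ω)) =
    (if ∃ o ∈ O, (openGraph (ω ∩ edgesIn U)).Reachable s o then (1 : ℝ)
      else h (⋃ o ∈ O, rC U o ω)) := by
  have : ω ∈ ⋂ o ∈ O, rD U o (∅ : Set V) := by
    simp only [Set.mem_iInter]
    exact fun o _ x hx => absurd hx (Set.notMem_empty x)
  rw [ind_of_mem this, one_mul]

/-- The cut sandwich function of `G[U ∖ Z]` does not depend on the pairs meeting `Z`. [folklore] -/
theorem sandH_diff_meeting (U Z : Finset V) (s : V) (O : Finset V) (h : Set (Sym2 V) → ℝ) (T : Set V)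
    (η : Set (Sym2 V)) :
    ind (⋂ o ∈ O, rD (U \ Z) o T) (η \ meeting Z) *
      (if ∃ o ∈ O, (openGraph ((η \ meeting Z) ∩ edgesIn (U \ Z))).Reachable s o then (1 : ℝ)
        else h (⋃ o ∈ O, rC (U \ Z) o (η \ meeting Z))) =
    ind (⋂ o ∈ O, rD (U \ Z) o T) η *
      (if ∃ o ∈ O, (openGraph (η ∩ edgesIn (U \ Z))).Reachable s o then (1 : ℝ)
        else h (⋃ o ∈ O, rC (U \ Z) o η)) := by
  have hind : ind (⋂ o ∈ O, rD (U \ Z) o T) (η \ meeting Z) = ind (⋂ o ∈ O, rD (U \ Z) o T) η := by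
    by_cases hη : η ∈ ⋂ o ∈ O, rD (U \ Z) o T
    · rw [ind_of_mem hη, ind_of_mem ((mem_iInter_rD_diff_meeting U Z O T η).2 hη)]
    · rw [ind_of_not_mem hη, ind_of_not_mem (fun h' => hη ((mem_iInter_rD_diff_meeting U Z O T η).1 h'))]
  simp only [rC_diff_meeting]
  rw [diff_meeting_inter_edgesIn, hind]

/-- BHK's restriction for the cut sandwich function (as `sandS_restrict`). [cite: VandenbergHaggstromKahn2005, §1 p. 4, identity (6)] -/
theorem sandH_restrict {U Z : Finset V} (hZU : Z ⊆ U) {s : V} (hs : s ∉ Z) {O : Finset V}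
    (hO : ∀ o ∈ O, o ∉ Z) (h : Set (Sym2 V) → ℝ) {W : Set V} (hZW : (↑Z : Set V) ⊆ W) {ω : Set (Sym2 V)}
    (hS : ∀ n ∈ rS U Z ω, ¬ (openGraph (ω ∩ edgesIn (U \ Z))).Reachable s n) :
    ind (⋂ o ∈ O, rD U o W) ω * (if ∃ o ∈ O, (openGraph (ω ∩ edgesIn U)).Reachable s o then (1 : ℝ)
      else h (⋃ o ∈ O, rC U o ω)) =
    ind (⋂ o ∈ O, rD (U \ Z) o ((W \ ↑Z) ∪ rS U Z ω)) ω *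
      (if ∃ o ∈ O, (openGraph (ω ∩ edgesIn (U \ Z))).Reachable s o then (1 : ℝ)
        else h (⋃ o ∈ O, rC (U \ Z) o ω)) := by
  have hreach : (∃ o ∈ O, (openGraph (ω ∩ edgesIn U)).Reachable s o) ↔
      ∃ o ∈ O, (openGraph (ω ∩ edgesIn (U \ Z))).Reachable s o :=
    exists_congr fun o => and_congr_right fun _ => reachable_restrict_iff hs hS o
  have hmem : ω ∈ (⋂ o ∈ O, rD U o W) ↔ ω ∈ ⋂ o ∈ O, rD (U \ Z) o ((W \ ↑Z) ∪ rS U Z ω) := by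
    simp only [Set.mem_iInter]
    exact forall₂_congr fun o ho => mem_rD_iff_restrict hZU (hO o ho) hZW ω
  by_cases hω : ω ∈ ⋂ o ∈ O, rD U o W
  · have hω' := hmem.1 hω
    rw [ind_of_mem hω, ind_of_mem hω']
    by_cases hr : ∃ o ∈ O, (openGraph (ω ∩ edgesIn (U \ Z))).Reachable s o
    · rw [if_pos (hreach.2 hr), if_pos hr]
    · rw [if_neg (fun h' => hr (hreach.1 h')), if_neg hr]
      congr 2
      refine Set.iUnion₂_congr fun o ho => rC_restrict (hO o ho) fun n hn => ?_
      exact (Set.mem_iInter₂.1 hω' o ho) n (Or.inr hn)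
  · rw [ind_of_not_mem hω, ind_of_not_mem (fun h' => hω (hmem.2 h')), zero_mul, zero_mul]

/-! ### Theorem S for an observer set: the base case `X ∩ Y = ∅` (abstract sandwich function) -/

/-- **Theorem S (set observer), base case `X ∩ Y = ∅`, for an ABSTRACT sandwich function** `g s U T ω`
that is nonnegative, antitone in `T`, and equal to `g₀ = 1{s ↔ O} + 1{s ↮ O} h(K_O)` at `T = ∅` (both the set
sandwich function `g^(T)` and its cut version `ĝ^(T)` qualify): for `F ≥ 0` increasing,
`E[F(C_s) 1_{R_X}] · E[g^(Y) 1_{R_Y}] ≤ E[F(C_s) g^(X∩Y) 1_{R_{X∩Y}}] · P(R_{X∪Y})` — Harris twice and Lemma U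
(set observer) twice, BHK's display (4). [cite: VandenbergHaggstromKahn2005, Thm. 1.1 (p. 4, display (4))] -/
theorem coreS_abs_base (w : Sym2 V → ℝ) (hw0 : ∀ e, 0 ≤ w e) (hw1 : ∀ e, w e ≤ 1)
    (hm : ∑ ω, weight w ω = 1) (O : Finset V) (h : Set (Sym2 V) → ℝ)
    (h1 : ∀ C, h C ≤ 1) (g : V → Finset V → Set V → Set (Sym2 V) → ℝ)
    (hg0 : ∀ s U T ω, 0 ≤ g s U T ω)
    (hgant : ∀ s U (T T' : Set V), T ⊆ T' → ∀ ω, g s U T' ω ≤ g s U T ω)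
    (hgempty : ∀ s U ω, g s U (∅ : Set V) ω = if ∃ o ∈ O, (openGraph (ω ∩ edgesIn U)).Reachable s o
      then (1 : ℝ) else h (⋃ o ∈ O, rC U o ω))
    (U : Finset V) (s : V) (X Y : Set V) (hXY : X ∩ Y = ∅)
    (F : Set (Sym2 V) → ℝ) (hF : Monotone F) (hF0 : ∀ a, 0 ≤ F a) :
    (∑ ω, weight w ω * (F (rC U s ω) * ind (rD U s X) ω)) *
      (∑ ω, weight w ω * (g s U Y ω * ind (rD U s Y) ω)) ≤
    (∑ ω, weight w ω * (F (rC U s ω) * g s U (X ∩ Y) ω * ind (rD U s (X ∩ Y)) ω)) *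
      (∑ ω, weight w ω * ind (rD U s (X ∪ Y)) ω) := by
  have g0 : ∀ (U' : Finset V) (T : Set V) ω, 0 ≤ g s U' T ω := fun U' T ω => hg0 s U' T ω
  have gant : ∀ (U' : Finset V) (T T' : Set V), T ⊆ T' → ∀ ω, g s U' T' ω ≤ g s U' T ω :=
    fun U' T T' hTT' ω => hgant s U' T T' hTT' ω
  rw [hXY]
  have hR0 : ∀ ω, ind (rD U s (∅ : Set V)) ω = 1 := fun ω =>
    ind_of_mem fun x hx _ => Set.notMem_empty x hx
  have hge : ∀ ω, g s U (∅ : Set V) ω =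
      (if ∃ o ∈ O, (openGraph (ω ∩ edgesIn U)).Reachable s o then (1 : ℝ)
        else h (⋃ o ∈ O, rC U o ω)) := fun ω => hgempty s U ω
  have hXuY : ∀ ω, ind (rD U s (X ∪ Y)) ω = ind (rD U s X) ω * ind (rD U s Y) ω := fun ω => by
    rw [rD_union, ind_inter]
  simp_rw [hR0, mul_one, hXuY]
  set EF := ∑ ω, weight w ω * F (rC U s ω) with hEF
  set PX := ∑ ω, weight w ω * ind (rD U s X) ω with hPX
  set PY := ∑ ω, weight w ω * ind (rD U s Y) ω with hPY
  set EG := ∑ ω, weight w ω * g s U (∅ : Set V) ω with hEG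
  set B0 := ∑ ω, weight w ω * (g s U (∅ : Set V) ω * ind (rD U s Y) ω) with hB0
  set EFG := ∑ ω, weight w ω * (F (rC U s ω) * g s U (∅ : Set V) ω) with hEFG
  have hFm : Monotone fun ω => F (rC U s ω) := fun a b hab => hF (rC_mono U s hab)
  -- (i) `g^(Y) ≤ g^(∅)`
  have hB : ∑ ω, weight w ω * (g s U Y ω * ind (rD U s Y) ω) ≤ B0 :=
    Finset.sum_le_sum fun ω _ => mul_le_mul_of_nonneg_left
      (mul_le_mul_of_nonneg_right (gant U ∅ Y (Set.empty_subset Y) ω) (ind_nonneg _ _))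
      (weight_nonneg hw0 hw1 ω)
  -- (ii) Harris for `F` and `R_X`
  have hA : ∑ ω, weight w ω * (F (rC U s ω) * ind (rD U s X) ω) ≤ EF * PX :=
    harris_mono_anti hw0 hw1 hm (fun _ => hF0 _) hFm
      (ind_rD_antitone U s X) (fun _ => ind_le_one _ _)
  -- (iii) Lemma U (set observer) for `1{s ↔ Y}` and `g^(∅)`: `B0 ≤ EG * PY`
  have hB0 : B0 ≤ EG * PY := by
    set F' : Set (Sym2 V) → ℝ := fun C => if ∃ y ∈ Y, y = s ∨ ∃ e ∈ C, y ∈ e then 1 else 0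
      with hF'
    have hF'm : Monotone F' := by
      intro C C' hCC'
      simp only [hF']
      by_cases hc : ∃ y ∈ Y, y = s ∨ ∃ e ∈ C, y ∈ e
      · have hc' : ∃ y ∈ Y, y = s ∨ ∃ e ∈ C', y ∈ e := by
          obtain ⟨y, hy, hy'⟩ := hc
          exact ⟨y, hy, hy'.imp id fun ⟨e, he, hye⟩ => ⟨e, hCC' he, hye⟩⟩
        rw [if_pos hc, if_pos hc']
      · rw [if_neg hc]; split_ifs
        · exact zero_le_one
        · exact le_rfl
    have hF'e : ∀ ω, F' (rC U s ω) = 1 - ind (rD U s Y) ω := by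
      intro ω
      simp only [hF']
      by_cases hω : ω ∈ rD U s Y
      · rw [ind_of_mem hω, if_neg]
        · ring
        · rintro ⟨y, hy, hy'⟩
          exact hω y hy ((reachable_iff_exists_mem_openEdgeCluster (ω ∩ edgesIn U) s y).2 hy')
      · rw [ind_of_not_mem hω, if_pos]
        · ring
        · simp only [rD, Set.mem_setOf_eq, not_forall, not_not] at hω
          obtain ⟨y, hy, hr⟩ := hω
          exact ⟨y, hy, (reachable_iff_exists_mem_openEdgeCluster (ω ∩ edgesIn U) s y).1 hr⟩
    have key := lemmaU_set_restrict w hw0 hw1 hm U s O F' hF'm h h1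
    simp_rw [← hge] at key
    have x1 : ∑ ω, weight w ω * F' (rC U s ω) = 1 - PY := by
      have := sum_affine w (fun ω => F' (rC U s ω)) (fun _ => 1) (ind (rD U s Y)) (ind (rD U s Y))
        (ind (rD U s Y)) 1 (-1) 0 0 (fun ω => by rw [hF'e]; ring)
      rw [this]; simp [hm]; ring
    have x2 : ∑ ω, weight w ω * (F' (rC U s ω) * g s U (∅ : Set V) ω) = EG - B0 := by
      have := sum_affine w (fun ω => F' (rC U s ω) * g s U (∅ : Set V) ω) (g s U (∅ : Set V))
        (fun ω => g s U (∅ : Set V) ω * ind (rD U s Y) ω) (ind (rD U s Y)) (ind (rD U s Y))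
        1 (-1) 0 0 (fun ω => by rw [hF'e]; ring)
      rw [this]; simp [hEG, hB0]; ring
    rw [x1, x2] at key
    nlinarith [key]
  -- (iv) Lemma U (set observer) for `F` and `g^(∅)`
  have hFG : EF * EG ≤ EFG := by
    have key := lemmaU_set_restrict w hw0 hw1 hm U s O F hF h h1
    simp_rw [← hge] at key
    exact key
  -- (v) Harris for `R_X` and `R_Y`
  have hP : PX * PY ≤ ∑ ω, weight w ω * (ind (rD U s X) ω * ind (rD U s Y) ω) :=
    harris_anti_anti hw0 hw1 hm (ind_rD_antitone U s X) (ind_rD_antitone U s Y)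
      (fun _ => ind_le_one _ _) (fun _ => ind_le_one _ _)
  have hA1n : 0 ≤ ∑ ω, weight w ω * (F (rC U s ω) * ind (rD U s X) ω) :=
    sum_ind_nonneg hw0 hw1 (fun _ => hF0 _) _
  have hB0n : 0 ≤ B0 := sum_ind_nonneg hw0 hw1 (fun ω => g0 U ∅ ω) _
  have hEFn : 0 ≤ EF := Finset.sum_nonneg fun ω _ => mul_nonneg (weight_nonneg hw0 hw1 ω) (hF0 _)
  have hEGn : 0 ≤ EG := Finset.sum_nonneg fun ω _ => mul_nonneg (weight_nonneg hw0 hw1 ω) (g0 _ _ _)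
  have hPXn : 0 ≤ PX := Finset.sum_nonneg fun ω _ => mul_nonneg (weight_nonneg hw0 hw1 ω) (ind_nonneg _ _)
  have hPYn : 0 ≤ PY := Finset.sum_nonneg fun ω _ => mul_nonneg (weight_nonneg hw0 hw1 ω) (ind_nonneg _ _)
  have hEFGn : 0 ≤ EFG := Finset.sum_nonneg fun ω _ => mul_nonneg (weight_nonneg hw0 hw1 ω)
    (mul_nonneg (hF0 _) (g0 _ _ _))
  calc (∑ ω, weight w ω * (F (rC U s ω) * ind (rD U s X) ω)) *
        (∑ ω, weight w ω * (g s U Y ω * ind (rD U s Y) ω))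
      ≤ (∑ ω, weight w ω * (F (rC U s ω) * ind (rD U s X) ω)) * B0 :=
        mul_le_mul_of_nonneg_left hB hA1n
    _ ≤ (EF * PX) * (EG * PY) := mul_le_mul hA hB0 hB0n (mul_nonneg hEFn hPXn)
    _ = (EF * EG) * (PX * PY) := by ring
    _ ≤ EFG * ∑ ω, weight w ω * (ind (rD U s X) ω * ind (rD U s Y) ω) :=
        mul_le_mul hFG hP (mul_nonneg hPXn hPYn) hEFGn

end SandwichSet

open scoped Classical in
open SandwichSet DecisionTree in
/-- **Registered stub `stub_coreSAbsBase_sp`** (= `SandwichSet.coreS_abs_base` on `Fin n`): the base case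
`X ∩ Y = ∅` of Theorem S for an observer set, for an abstract sandwich function.
[cite: VandenbergHaggstromKahn2005, Thm. 1.1 (p. 4, display (4))] -/
theorem stub_coreSAbsBase_sp : ∀ (n : ℕ) (w : Sym2 (Fin n) → ℝ), (∀ e, 0 ≤ w e) → (∀ e, w e ≤ 1) → ∑ ω, BHK2006.weight w ω = 1 → ∀ (O : Finset (Fin n)) (h : Set (Sym2 (Fin n)) → ℝ), (∀ C, h C ≤ 1) → ∀ (g : Fin n → Finset (Fin n) → Set (Fin n) → Set (Sym2 (Fin n)) → ℝ), (∀ s U T ω, 0 ≤ g s U T ω) → (∀ s U (T T' : Set (Fin n)), T ⊆ T' → ∀ ω, g s U T' ω ≤ g s U T ω) → (∀ s U ω, g s U (∅ : Set (Fin n)) ω = if ∃ o ∈ O, (openGraph (ω ∩ BHK2006.edgesIn U)).Reachable s o then (1 : ℝ) else h (⋃ o ∈ O, BHK2006.rC U o ω)) → ∀ (U : Finset (Fin n)) (s : Fin n) (X Y : Set (Fin n)), X ∩ Y = ∅ → ∀ (F : Set (Sym2 (Fin n)) → ℝ), Monotone F → (∀ a, 0 ≤ F a) → (∑ ω, BHK2006.weight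 w ω * (F (BHK2006.rC U s ω) * DecisionTree.ind (BHK2006.rD U s X) ω)) * (∑ ω, BHK2006.weight w ω * (g s U Y ω * DecisionTree.ind (BHK2006.rD U s Y) ω)) ≤ (∑ ω, BHK2006.weight w ω * (F (BHK2006.rC U s ω) * g s U (X ∩ Y) ω * DecisionTree.ind (BHK2006.rD U s (X ∩ Y)) ω)) * (∑ ω, BHK2006.weight w ω * DecisionTree.ind (BHK2006.rD U s (X ∪ Y)) ω) :=
  fun _ w hw0 hw1 hm O h h1 g hg0 hgant hgempty U s X Y hXY F hF hF0 => by
    convert coreS_abs_base w hw0 hw1 hm O h h1 g hg0 hgant (fun s U ω => by convert hgempty s U ω using 2)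
      U s X Y hXY F hF hF0 using 4

end Summit.CriticalPhenomena.PercolationContinuityZ3.Theorems
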